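import Mathlib
import Literature.AlgebraicGeometry.ComplexMultiplication.ShimuraInflationRationalOfRiemann
import Literature.AlgebraicGeometry.ComplexMultiplication.PrincipalModelOfCMOrder
import Literature.AlgebraicGeometry.Motives.AbelianVariety
import HarnessLib

/-!
# COR-CM (cell `pub-hodgecm2`), André 1992 in product form — part 1: Galois bookkeeping, the integral
# separating element and its minimal polynomial, the diagonal `𝓞_K`-action as a ring homomorphism

HONEST FRAMING (cell pub-hodgecm2 / COR-CM, literature seat André): elementary number-field and
biproduct bookkeeping for the kernel proof of the Literature record
`HodgeTheory.Andre1992_hodgeClasses_cmTypedProduct_mem_span_pullback_weilLines` (André 1992 in product form;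
file `CorCM/AndreProductFormHolds.lean`); no case of the Hodge conjecture is proved and nothing about
algebraic cycles is asserted. Contents (all PROVED, definitions are proof-internal bookkeeping):

* for `K` Galois over `ℚ`: `g ↦ s ∘ g` is a bijection `Gal(K/ℚ) → Hom(K, ℂ)` (`comp_gal_bijective`), its
  inverse `galOf`, the label `σ ∘ g⁻¹` of a pair `(g, σ)` and the reindexing `pairEquiv`;
* an INTEGRAL element `a₀ ∈ 𝓞_K` separating the complex embeddings (`exists_integer_separating`) and the
  facts about its integer minimal polynomial (`minpoly_facts`: monic, irreducible over `ℚ`, degree `[K:ℚ]`,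
  roots `σ(a₀)`, `P(a₀) = 0`) — the single-generator presentation `F = ℚ(a₀) = ℚ[T]/(P)` used by the tree's
  Moonen–Zarhin carrier `weilClassesField`;
* the diagonal action `a ↦ ⊕_j act_j(a)` on a finite biproduct of abelian varieties as a ring homomorphism
  `𝓞_K → End(⨁ B)` (`diagEnd`; the tree's `HodgeTheory.diagonalAction` is its value), with
  `x·𝟙 + y·act(a₀) = act(x + y a₀)` and `P(act a₀) = act(P(a₀))`.

## References
* [Shimura1998] G. Shimura, *Abelian Varieties with Complex Multiplication and Modular Functions* (1998), §5.2, §8.1.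
* [Deligne1982HodgeCycles] P. Deligne (notes by J. S. Milne), LNM 900 (1982), Milne's endnote M.12 (let `E` act on `A_J`).
-/

noncomputable section

namespace Summit.HodgeConjecture.CorCM.AndreProductForm

open NumberField

variable (K : Type) [Field K] [NumberField K]

/-- The label `σ ∘ g⁻¹` of the pair `(g, σ)`. [folklore] -/
def label (g : K ≃ₐ[ℚ] K) (σ : K →+* ℂ) : K →+* ℂ := σ.comp g.symm.toRingEquiv.toRingHom

/-- `(σ ∘ g⁻¹) ∘ g = σ`. [folklore] -/
theorem label_comp (g : K ≃ₐ[ℚ] K) (σ : K →+* ℂ) :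
    (label K g σ).comp g.toRingEquiv.toRingHom = σ := by
  ext x; simp [label]

/-- Unfolding of `label`. [folklore] -/
theorem label_apply (g : K ≃ₐ[ℚ] K) (σ : K →+* ℂ) (x : K) : label K g σ x = σ (g.symm x) := rfl

/-- An INTEGRAL element separating the complex embeddings. [folklore] -/
theorem exists_integer_separating :
    ∃ a₀ : 𝓞 K, Function.Injective fun σ : K →+* ℂ => σ (a₀ : K) := by
  classical
  set θ := (Field.powerBasisOfFiniteOfSeparable ℚ K).gen with hθ
  haveI : Algebra.IsAlgebraic ℤ ℚ := IsLocalization.isAlgebraic ℚ (nonZeroDivisors ℤ)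
  have hθalg : IsAlgebraic ℤ θ :=
    (Algebra.IsAlgebraic.isAlgebraic_iff (R := ℤ) (S := ℚ)).mpr (Algebra.IsAlgebraic.isAlgebraic θ)
  obtain ⟨d, hd0, hint⟩ := hθalg.exists_integral_multiple
  refine ⟨⟨d • θ, hint⟩, fun σ τ h => ?_⟩
  apply Literature.AlgebraicGeometry.ComplexMultiplication.ringHom_apply_gen_injective K
  have h' : σ (d • θ) = τ (d • θ) := h
  rw [map_zsmul, map_zsmul] at h'
  simpa [hd0] using h'

section Galois

variable [IsGalois ℚ K]

/-- The map `g ↦ s ∘ g` from `Gal(K/ℚ)` to the complex embeddings is bijective (K Galois). [folklore] -/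
theorem comp_gal_bijective (s : K →+* ℂ) :
    Function.Bijective fun g : K ≃ₐ[ℚ] K => s.comp g.toRingEquiv.toRingHom := by
  classical
  rw [Fintype.bijective_iff_injective_and_card]
  refine ⟨fun g g' h => ?_, ?_⟩
  · apply AlgEquiv.ext
    intro x
    have := RingHom.congr_fun h x
    exact s.injective (by simpa using this)
  · rw [← Nat.card_eq_fintype_card]
    exact (IsGalois.card_aut_eq_finrank ℚ K).trans (Embeddings.card K ℂ).symm

/-- `galOf s σ`: the unique `g ∈ Gal(K/ℚ)` with `s ∘ g = σ`. [folklore] -/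
def galOf (s σ : K →+* ℂ) : K ≃ₐ[ℚ] K :=
  (Equiv.ofBijective _ (comp_gal_bijective K s)).symm σ

/-- `s ∘ galOf s σ = σ`. [folklore] -/
theorem comp_galOf (s σ : K →+* ℂ) : s.comp (galOf K s σ).toRingEquiv.toRingHom = σ :=
  (Equiv.ofBijective _ (comp_gal_bijective K s)).apply_symm_apply σ

/-- `galOf s (s ∘ g) = g`. [folklore] -/
theorem galOf_comp (s : K →+* ℂ) (g : K ≃ₐ[ℚ] K) : galOf K s (s.comp g.toRingEquiv.toRingHom) = g :=
  (Equiv.ofBijective _ (comp_gal_bijective K s)).symm_apply_apply g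

/-- `galOf (σ ∘ g⁻¹) σ = g`. [folklore] -/
theorem galOf_label (g : K ≃ₐ[ℚ] K) (σ : K →+* ℂ) : galOf K (label K g σ) σ = g := by
  have h := galOf_comp K (label K g σ) g
  rwa [label_comp] at h

/-- The label of `(galOf s σ, σ)` is `s`. [folklore] -/
theorem label_galOf (s σ : K →+* ℂ) : label K (galOf K s σ) σ = s := by
  have h := comp_galOf K s σ
  ext x
  rw [label_apply]
  have := RingHom.congr_fun h ((galOf K s σ).symm x)
  simp at this
  exact this.symm

/-- The reindexing `(g, σ) ↦ (σ, σ ∘ g⁻¹)` with inverse `(σ, s) ↦ (galOf s σ, σ)`. [folklore] -/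
def pairEquiv : (K ≃ₐ[ℚ] K) × (K →+* ℂ) ≃ (K →+* ℂ) × (K →+* ℂ) where
  toFun p := (p.2, label K p.1 p.2)
  invFun q := (galOf K q.2 q.1, q.1)
  left_inv p := by
    rcases p with ⟨g, σ⟩
    simp [galOf_label]
  right_inv q := by
    rcases q with ⟨σ, s⟩
    simp [label_galOf]

end Galois


/-! ## The diagonal `𝓞_K`-action on a finite biproduct as a ring homomorphism -/

section DiagEnd

open CategoryTheory CategoryTheory.Limits
open Literature.AlgebraicGeometry Literature.AlgebraicGeometry.Motives Literature.AlgebraicGeometry.HodgeTheory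

variable {J : Type} [Fintype J] (B : J → AbelianVariety ℂ) (act : ∀ j, 𝓞 K →+* End (B j))

/-- The diagonal action `a ↦ ⊕_j act_j(a)` on `⨁ B` (the tree's `HodgeTheory.diagonalAction`, here over an
arbitrary finite index type). [cite: Deligne1982HodgeCycles, endnote M.12 (let E act on A_J)] -/
abbrev diagHom (a : 𝓞 K) : (⨁ B) ⟶ ⨁ B := biproduct.map fun j => act j a

omit [NumberField K] in
/-- The diagonal action of `1` is the identity. [folklore] -/
theorem diagHom_one : diagHom K B act 1 = 𝟙 (⨁ B) := by
  ext j; simp [diagHom, End.one_def]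

omit [NumberField K] in
/-- The diagonal action is multiplicative (composition reversed, as in `End`). [folklore] -/
theorem diagHom_mul (a b : 𝓞 K) : diagHom K B act (a * b) = diagHom K B act b ≫ diagHom K B act a := by
  ext j; simp [diagHom, End.mul_def]

omit [NumberField K] in
/-- The diagonal action of `0` is `0`. [folklore] -/
theorem diagHom_zero : diagHom K B act 0 = 0 := by
  apply biproduct.hom_ext
  intro j
  rw [diagHom, biproduct.map_π, map_zero, zero_comp]
  exact comp_zero

omit [NumberField K] in
/-- The diagonal action is additive. [folklore] -/
theorem diagHom_add (a b : 𝓞 K) : diagHom K B act (a + b) = diagHom K B act a + diagHom K B act b := by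
  apply biproduct.hom_ext
  intro j
  rw [diagHom, biproduct.map_π, map_add, Preadditive.add_comp, biproduct.map_π, biproduct.map_π]
  exact Preadditive.comp_add _ _ _ _ _ _

/-- The diagonal action as a ring homomorphism `𝓞_K → End(⨁ B)`. [cite: Deligne1982HodgeCycles, endnote M.12] -/
def diagEnd : 𝓞 K →+* End (⨁ B) where
  toFun a := diagHom K B act a
  map_one' := diagHom_one K B act
  map_mul' a b := diagHom_mul K B act a b
  map_zero' := diagHom_zero K B act
  map_add' a b := diagHom_add K B act a b

omit [NumberField K] in
/-- Unfolding of `diagEnd`. [folklore] -/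
theorem diagEnd_apply (a : 𝓞 K) : diagEnd K B act a = diagHom K B act a := rfl

omit [NumberField K] in
/-- `x·𝟙 + y·(act a₀) = act(x + y a₀)` as endomorphisms of `⨁ B`. [folklore] -/
theorem nsmul_id_add_nsmul_diagHom (a₀ : 𝓞 K) (x y : ℕ) :
    x • 𝟙 (⨁ B) + y • diagHom K B act a₀ = diagHom K B act ((x : 𝓞 K) + (y : 𝓞 K) * a₀) := by
  have h : diagEnd K B act ((x : 𝓞 K) + (y : 𝓞 K) * a₀) =
      x • (1 : End (⨁ B)) + y • diagEnd K B act a₀ := by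
    rw [map_add, map_mul, map_natCast, map_natCast, ← nsmul_one x, ← nsmul_one y, smul_mul_assoc,
      one_mul]
  exact h.symm

omit [NumberField K] in
/-- `P(act a₀) = act(P(a₀))` for integer polynomials. [folklore] -/
theorem eval₂_diagEnd (a₀ : 𝓞 K) (P : Polynomial ℤ) :
    Polynomial.eval₂ (Int.castRingHom (End (⨁ B))) (diagEnd K B act a₀) P =
      diagEnd K B act (Polynomial.eval₂ (Int.castRingHom (𝓞 K)) a₀ P) := by
  rw [Polynomial.hom_eval₂]
  congr 1
  exact RingHom.ext_int _ _

end DiagEnd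

section Minpoly

open Polynomial NumberField
open scoped IntermediateField

/-- The minimal polynomial of an integral element separating the complex embeddings: monic,
irreducible over `ℚ`, of degree `[K:ℚ]`, with roots the `σ(a₀)`. [folklore] -/
theorem minpoly_facts (a₀ : 𝓞 K) (hsep : Function.Injective fun σ : K →+* ℂ => σ (a₀ : K)) :
    (minpoly ℤ a₀).Monic ∧
    Irreducible ((minpoly ℤ a₀).map (Int.castRingHom ℚ)) ∧
    (minpoly ℤ a₀).natDegree = Module.finrank ℚ K ∧
    (∀ σ : K →+* ℂ, Polynomial.eval₂ (Int.castRingHom ℂ) (σ (a₀ : K)) (minpoly ℤ a₀) = 0) ∧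
    Polynomial.eval₂ (Int.castRingHom (𝓞 K)) a₀ (minpoly ℤ a₀) = 0 := by
  have hint : IsIntegral ℤ a₀ := RingOfIntegers.isIntegral a₀
  have hintK : IsIntegral ℤ (a₀ : K) := RingOfIntegers.isIntegral_coe a₀
  have heq : minpoly ℤ (a₀ : K) = minpoly ℤ a₀ :=
    minpoly.algebraMap_eq (IsFractionRing.injective (𝓞 K) K) a₀
  have hmapQ : (minpoly ℤ a₀).map (Int.castRingHom ℚ) = minpoly ℚ (a₀ : K) := by
    rw [← heq, ← algebraMap_int_eq, ← minpoly.isIntegrallyClosed_eq_field_fractions' ℚ hintK]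
  have hprim : ℚ⟮(a₀ : K)⟯ = ⊤ := by
    rw [Field.primitive_element_iff_algHom_eq_of_eval' ℚ ℂ (fun x => IsAlgClosed.splits _) (a₀ : K)]
    intro φ ψ h
    have h' : (φ : K →+* ℂ) = (ψ : K →+* ℂ) := hsep h
    exact AlgHom.coe_ringHom_injective h'
  refine ⟨minpoly.monic hint, ?_, ?_, ?_, ?_⟩
  · rw [hmapQ]; exact minpoly.irreducible hintK.tower_top
  · rw [← Polynomial.natDegree_map_eq_of_injective (Int.castRingHom ℚ).injective_int, hmapQ]
    exact (Field.primitive_element_iff_minpoly_natDegree_eq ℚ (a₀ : K)).mp hprim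
  · intro σ
    have h1 : Polynomial.aeval (σ.toRatAlgHom (a₀ : K)) (minpoly ℚ (a₀ : K)) = 0 := by
      rw [Polynomial.aeval_algHom_apply, minpoly.aeval, map_zero]
    have h2 : Polynomial.eval₂ (Int.castRingHom ℂ) (σ (a₀ : K)) (minpoly ℤ a₀) =
        Polynomial.aeval (σ (a₀ : K)) ((minpoly ℤ a₀).map (Int.castRingHom ℚ)) := by
      rw [Polynomial.aeval_def, Polynomial.eval₂_map]
      congr 1
    rw [h2, hmapQ]
    exact h1
  · have := minpoly.aeval ℤ a₀
    rwa [Polynomial.aeval_def, algebraMap_int_eq] at this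

end Minpoly



end Summit.HodgeConjecture.CorCM.AndreProductForm
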